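/-
Copyright: the b2b-balaban T⁴-continuum CRUX team, row NE7b leaf lineage `t4-ne7b-formalise-leaf-06` (gen 153). Project licence.
-/
import Mathlib.Analysis.Calculus.ContDiff.Basic
import Mathlib.Topology.Algebra.Module.FiniteDimension
import Mathlib.Analysis.Normed.Module.FiniteDimension
import Mathlib.Analysis.SpecialFunctions.Trigonometric.Basic

/-!
# CUBIC SYMMETRY MAKES THE MARGINAL PART ISOTROPIC: a scalar kernel on `ι → ℝ` invariant under the SIGNED PERMUTATIONS of the
# coordinates (the hyperoctahedral group of the lattice `ℤ^ι`) has Hessian at `0` equal to `b·Σ_j q_j²` — IHPC's letter (S) «the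
# quadratic part is a multiple of the main form» FROM A SYMMETRY, exactly as its letter (R) «no odd terms» comes from reflection symmetry;
# no lattice-anisotropic marginal remainder survives for SCALAR kernels (row NE7b, node U5c; [folklore] linear algebra + the chain rule)

Cell `pub-balaban`, sub-cell `t4`, spine estimate NE7b (`T4WeightBudget.RelWeightBound`; the cell's OWN estimate — NOT PRINTED in
[Bałaban 1983–89], NOT PROVED).  Crux-route work under `Spine/NE7b/` by a row leaf on the convexity road under FREEZE (0)'s crux-prover
clause; NOTHING of Bałaban's is named or asserted; no `T4Continuum/Support` leaf typed; no `def`; zero `sorry`.  Imports: Mathlib only —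
independent of the farm's olean frontier (`…InheritedHessianPowerCounting` (IHPC, p376809 ✓) and `…LatticeKernelMoments` (LKM) have no
hub olean; nothing of theirs is imported or restated — IHPC §6 consumes the (S) display `Φₙ q = bₙ·m(q) + Rₙ q` as a hypothesis, and this
file's END is that display's quadratic part with `m(q) = Σ_j q_j²`).

WHY.  Leaf-01's IHPC §6 (`sum_rescaled_split`, `floor_uniform_of_split`) absorbs into the running coefficient ONLY the part of each
inherited kernel's quadratic term that is a multiple of the main form `m`; its NOT-HERE says «lattice-anisotropic marginal parts (only the
multiple of the main form is absorbed in §6 — any other quadratic part must be carried as a remainder with its own letter)», and LKM's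
NOT-HERE repeats «the marginal part's split into multiple of the main form + anisotropic remainder».  For SCALAR kernels on a hypercubic
lattice there is NO anisotropic remainder, for a reason of the same kind as IHPC's (R): the kernel inherits the lattice's point group, the
signed permutations of the coordinates, and a quadratic form on `ℝ^ι` invariant under every coordinate sign flip and every coordinate
permutation is a multiple of `Σ_j q_j²` — sign flips kill the off-diagonal coefficients, permutations equalise the diagonal ones.  THIS FILE
types that: (§1) invariance of `Φ` under a continuous linear equivalence `A` passes to every `DⁿΦ(0)` (Mathlib's
`ContinuousLinearEquiv.iteratedFDerivWithin_comp_right`, no differentiability hypothesis — the junk values are equivariant too); (§2) the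
linear algebra for a continuous bilinear form on `ι → ℝ` (coordinate peeling: `B(q' + c e_j) = B(q' − c e_j)` kills the cross term, so
`B q q = Σ_j q_j²·B e_j e_j`; a transposition carries `e_j` to `e_i`); (§3) the END for the Hessian `D²Φ(0)[q,q]`; (§4) LKM's `d`-dimensional
lattice symbol `Φ(p) = Σ_{x∈s} k x·cos⟨x, p⟩` (WRITTEN OUT, nothing of LKM's imported) IS cubic-symmetric when the support `s` and the
weights `k` are, so §3 applies to it; (§5) a toy.  Honest limit:
for FORM-valued (polarisation-indexed) kernels the hyperoctahedral group has MORE quadratic invariants than `O(ι)` (`δ_μν Σ_j q_j²`, `q_μ q_ν`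
AND the lattice term `δ_μν q_μ²`), so an anisotropic marginal remainder CAN survive there — not this file (scalar currency, as IHPC §6).

WHAT IS PROVED ([folklore]; `ι` a finite type with decidable equality, `E`, `F` real normed spaces):
* §1 SYMMETRY PASSES TO THE DERIVATIVES AT `0`: `iteratedFDeriv_comp_continuousLinearEquiv_apply` (`Dⁿ(Φ ∘ A)(x)[m] = DⁿΦ(A x)[A ∘ m]`, any
  `A : E ≃L[ℝ] E`, any `Φ`, no regularity asked), **`iteratedFDeriv_apply_equiv_of_invariant`** (`Φ ∘ A = Φ ⟹ DⁿΦ(A x)[A ∘ m] = DⁿΦ(x)[m]`),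
  `iteratedFDeriv_zero_apply_equiv_of_invariant` (at `x = 0`), **`hessian_apply_equiv_of_invariant`** (`D²Φ(0)(A u)(A v) = D²Φ(0) u v` in
  Mathlib's curried currency `fderiv ℝ (fderiv ℝ Φ) 0`).
* §2 THE LINEAR ALGEBRA on `ι → ℝ` for a continuous bilinear `B`: **`diag_eq_sum_sq_mul_of_flip_invariant`** (`B` invariant on the diagonal
  under every coordinate sign flip `q ↦ update q j (−q j)` ⟹ `B q q = Σ_j q_j²·B e_j e_j`, `e_j = Pi.single j 1` — by induction on the
  support, peeling one coordinate at a time), `single_comp_swap` (`e_j ∘ swap i j = e_i`), `diag_single_eq_of_perm_invariant` (permutation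
  invariance ⟹ `B e_j e_j = B e_i e_i`), **`diag_eq_mul_sum_sq`** (both ⟹ `B q q = B e_{i₀} e_{i₀} · Σ_j q_j²`).
* §3 THE END **`hessian_diag_eq_mul_sum_sq`**: `Φ : (ι → ℝ) → ℝ` with `Φ (update q j (−q j)) = Φ q` and `Φ (q ∘ σ) = Φ q` for all `j`, all
  `σ : Equiv.Perm ι`, all `q` ⟹ `D²Φ(0)[q,q] = D²Φ(0)[e_{i₀},e_{i₀}] · Σ_j q_j²` — IHPC's (S) with `m(q) = Σ_j q_j²` (so `μ = 1` for the sup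
  norm of `ι → ℝ`, since `‖q‖_∞² ≤ Σ_j q_j²`: `norm_sq_le_sum_sq`) and `bₙ = ½D²Φₙ(0)[e_{i₀},e_{i₀}]` (`half_hessian_diag_eq`, IHPC §6's `hsplit`
  shape); the flips and permutations are realised as continuous linear equivalences of the finite-dimensional `ι → ℝ` inside the proof
  (`LinearEquiv.ofInvolutive`, `LinearEquiv.funCongrLeft`, `LinearEquiv.toContinuousLinearEquiv`); no regularity of `Φ` is asked.
* §4 LKM's LATTICE SYMBOL, WRITTEN OUT (`s : Finset (ι → ℤ)`, `k : (ι → ℤ) → ℝ`, `Φ(p) = Σ_{x∈s} k x·cos(Σ_i x_i p_i)`):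
  `latticeSymbol_eq_of_symmetry` (transport by an index symmetry `g` dual to the momentum map: `Finset.sum_equiv`),
  **`latticeSymbol_flip_invariant`** (support and weights invariant under `x ↦ update x j (−x j)` ⟹ `Φ (update p j (−p j)) = Φ p`),
  **`latticeSymbol_perm_invariant`** (invariant under every `x ↦ x ∘ σ` ⟹ `Φ (p ∘ σ) = Φ p`; the dual index map is `x ↦ x ∘ σ⁻¹`),
  **`latticeSymbol_hessian_diag_eq_mul_sum_sq`** (THE END for a cubic-symmetric lattice kernel: `D²Φ(0)[q,q] = D²Φ(0)[e_{i₀},e_{i₀}]·Σ_j q_j²`).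
* §5 toy (kernel): the hypotheses are inhabited (`Φ = Σ_j q_j²` is flip- and permutation-invariant) and the END specialises.

NOT HERE (honest): FORM-valued kernels (three hyperoctahedral quadratic invariants — an anisotropic marginal remainder may survive; its
letter is IHPC's business); the junction with LKM's one-variable ray letters and second moments BY IMPORT (olean-gated — §4 writes the
symbol out in LKM's shape instead); infinite support (`tsum` symbols); WHICH of print's inherited kernels are cubic-symmetric ((A3) ∕ (A1c) readings,
NC-NE7b-α UNRULED — in shape: every term generated by a hypercubic-lattice RG from a cubic-symmetric action); anything of Bałaban's.
BY-NAME EFFECT ON THE WALL: NONE (a supplier for IHPC's displayed letter (S)).  NE7b NOT PRINTED ∕ NOT PROVED; spine PROVED 0∕9; rung (B)+1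
on a FINITE torus — NOT infinite volume, NOT the mass gap, NOT Clay.  HONEST DEPENDENCY: continuum YM on T⁴ ⇐ BetaPertH ∧ nine spine
estimates (0∕9 proved); BetaPertH ⇐ (D1) ∧ (D4) ∧ CAP+tail; G-an2-4 gates asym, D1 and NE2∕3∕4.
-/

set_option autoImplicit false

noncomputable section

open Set Function

namespace Summit.QuantumFields.BalabanUV.T4Continuum.NE7b.CubicSymmetricKernelMarginal

/-! ## §1 Symmetry passes to the derivatives at `0` -/

section Invariance

variable {E F : Type*} [NormedAddCommGroup E] [NormedSpace ℝ E] [NormedAddCommGroup F] [NormedSpace ℝ F]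

/-- **THE CHAIN RULE FOR A LINEAR CHANGE OF VARIABLES, AT EVERY ORDER, NO REGULARITY ASKED**: `Dⁿ(Φ ∘ A)(x)[m] = DⁿΦ(A x)[A ∘ m]` for a
continuous linear equivalence `A` (Mathlib's `ContinuousLinearEquiv.iteratedFDerivWithin_comp_right` on `univ`; Mathlib's junk values of
`iteratedFDeriv` are equivariant, so no `ContDiff` hypothesis is needed). [folklore] -/
theorem iteratedFDeriv_comp_continuousLinearEquiv_apply (A : E ≃L[ℝ] E) (Φ : E → F) (x : E) (n : ℕ) (m : Fin n → E) :
    iteratedFDeriv ℝ n (Φ ∘ A) x m = iteratedFDeriv ℝ n Φ (A x) fun i => A (m i) := by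
  have h := A.iteratedFDerivWithin_comp_right Φ uniqueDiffOn_univ (mem_univ (A x)) n
  rw [preimage_univ, iteratedFDerivWithin_univ, iteratedFDerivWithin_univ] at h
  rw [h, ContinuousMultilinearMap.compContinuousLinearMap_apply]
  rfl

/-- **SYMMETRY PASSES TO THE DERIVATIVES**: `Φ ∘ A = Φ` ⟹ `DⁿΦ(A x)[A m₁, …, A mₙ] = DⁿΦ(x)[m₁, …, mₙ]`. [folklore] -/
theorem iteratedFDeriv_apply_equiv_of_invariant (A : E ≃L[ℝ] E) {Φ : E → F} (hΦ : ∀ q, Φ (A q) = Φ q) (x : E) (n : ℕ)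
    (m : Fin n → E) : (iteratedFDeriv ℝ n Φ (A x) fun i => A (m i)) = iteratedFDeriv ℝ n Φ x m := by
  have hfun : Φ ∘ A = Φ := funext hΦ
  rw [← iteratedFDeriv_comp_continuousLinearEquiv_apply, hfun]

/-- At the fixed point `0` of every linear symmetry: `DⁿΦ(0)[A m₁, …, A mₙ] = DⁿΦ(0)[m₁, …, mₙ]`. [folklore] -/
theorem iteratedFDeriv_zero_apply_equiv_of_invariant (A : E ≃L[ℝ] E) {Φ : E → F} (hΦ : ∀ q, Φ (A q) = Φ q) (n : ℕ)
    (m : Fin n → E) : (iteratedFDeriv ℝ n Φ 0 fun i => A (m i)) = iteratedFDeriv ℝ n Φ 0 m := by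
  simpa using iteratedFDeriv_apply_equiv_of_invariant A hΦ 0 n m

/-- **THE HESSIAN AT `0` IS INVARIANT** (Mathlib's curried currency `fderiv ℝ (fderiv ℝ Φ) 0 : E →L E →L F`, `iteratedFDeriv_two_apply`):
`Φ ∘ A = Φ` ⟹ `D²Φ(0)(A u)(A v) = D²Φ(0) u v`. [folklore] -/
theorem hessian_apply_equiv_of_invariant (A : E ≃L[ℝ] E) {Φ : E → F} (hΦ : ∀ q, Φ (A q) = Φ q) (u v : E) :
    fderiv ℝ (fderiv ℝ Φ) 0 (A u) (A v) = fderiv ℝ (fderiv ℝ Φ) 0 u v := by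
  have h := iteratedFDeriv_zero_apply_equiv_of_invariant A hΦ 2 ![u, v]
  rw [iteratedFDeriv_two_apply, iteratedFDeriv_two_apply] at h
  simpa using h

end Invariance

/-! ## §2 The linear algebra: a flip- and permutation-invariant quadratic form on `ι → ℝ` is `b·Σ_j q_j²` -/

section Algebra

variable {ι : Type*} [Fintype ι] [DecidableEq ι]

/-- **SIGN FLIPS KILL THE CROSS TERMS**: a continuous bilinear form `B` on `ι → ℝ` whose diagonal `q ↦ B q q` is invariant under every
coordinate sign flip `q ↦ update q j (−q j)` satisfies `B q q = Σ_j q_j²·B e_j e_j` (`e_j = Pi.single j 1`).  Proof by peeling the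
support: `q = q' + c·e_j` with `q'_j = 0`, the flip gives `q' − c·e_j`, and `B(q' ± c e_j) = B q' q' + c²B e_j e_j ± c·(B q' e_j + B e_j q')`,
so invariance kills the cross term. [folklore] -/
theorem diag_eq_sum_sq_mul_of_flip_invariant (B : (ι → ℝ) →L[ℝ] (ι → ℝ) →L[ℝ] ℝ)
    (hflip : ∀ (j : ι) (q : ι → ℝ), B (update q j (-q j)) (update q j (-q j)) = B q q) (q : ι → ℝ) :
    B q q = ∑ j, q j ^ 2 * B (Pi.single j 1) (Pi.single j 1) := by
  -- induction on the support
  suffices h : ∀ (s : Finset ι) (q : ι → ℝ), (∀ j, j ∉ s → q j = 0) →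
      B q q = ∑ j ∈ s, q j ^ 2 * B (Pi.single j 1) (Pi.single j 1) from
    h Finset.univ q fun j hj => absurd (Finset.mem_univ j) hj
  intro s
  induction s using Finset.induction_on with
  | empty =>
    intro q hq
    have hq0 : q = 0 := funext fun j => hq j (by simp)
    simp [hq0]
  | @insert j s hjs ih =>
    intro q hq
    -- peel the coordinate `j`
    set q' : ι → ℝ := update q j 0 with hq'
    have hq's : ∀ i, i ∉ s → q' i = 0 := by
      intro i hi
      by_cases hij : i = j
      · subst hij; simp [hq']
      · have : i ∉ insert j s := by simp [hij, hi]
        simp [hq', hij, hq i this]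
    have hdec : q = q' + q j • Pi.single j (1 : ℝ) := by
      funext i
      by_cases hij : i = j
      · subst hij; simp [hq']
      · simp [hq', hij]
    have hflipdec : update q j (-q j) = q' + (-q j) • Pi.single j (1 : ℝ) := by
      funext i
      by_cases hij : i = j
      · subst hij; simp [hq']
      · simp [hq', hij]
    -- bilinear expansions
    have hexp : ∀ c : ℝ, B (q' + c • Pi.single j (1 : ℝ)) (q' + c • Pi.single j (1 : ℝ))
        = B q' q' + c ^ 2 * B (Pi.single j 1) (Pi.single j 1)
          + c * (B q' (Pi.single j 1) + B (Pi.single j 1) q') := by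
      intro c
      simp only [map_add, map_smul, FunLike.coe_add, FunLike.coe_smul, Pi.add_apply, Pi.smul_apply, smul_eq_mul]
      ring
    have hqq := hexp (q j)
    rw [← hdec] at hqq
    have hff := hexp (-q j)
    rw [← hflipdec, hflip j q] at hff
    have hkill : q j * (B q' (Pi.single j 1) + B (Pi.single j 1) q') = 0 := by
      have hsq : (-q j) ^ 2 = q j ^ 2 := by ring
      rw [hsq] at hff
      linarith [hqq, hff]
    have hIH := ih q' hq's
    have hsame : ∑ i ∈ s, q' i ^ 2 * B (Pi.single i 1) (Pi.single i 1) = ∑ i ∈ s, q i ^ 2 * B (Pi.single i 1) (Pi.single i 1) := by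
      refine Finset.sum_congr rfl fun i hi => ?_
      have hij : i ≠ j := fun h => hjs (h ▸ hi)
      simp [hq', hij]
    rw [Finset.sum_insert hjs, hqq, hIH, hsame]
    linarith [hkill]

omit [Fintype ι] in
/-- A transposition carries one coordinate vector to another: `e_j ∘ swap i j = e_i`. [folklore] -/
theorem single_comp_swap (i j : ι) : (Pi.single j (1 : ℝ)) ∘ (Equiv.swap i j) = Pi.single i 1 := by
  funext k
  rcases eq_or_ne k i with rfl | hki
  · simp
  · rcases eq_or_ne k j with rfl | hkj
    · simp [Equiv.swap_apply_right, hki, hki.symm]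
    · simp [Equiv.swap_apply_of_ne_of_ne hki hkj, hki, hkj]

omit [Fintype ι] in
/-- **PERMUTATIONS EQUALISE THE DIAGONAL**: if the diagonal of `B` is invariant under every coordinate permutation `q ↦ q ∘ σ`, then
`B e_j e_j = B e_i e_i`. [folklore] -/
theorem diag_single_eq_of_perm_invariant (B : (ι → ℝ) →L[ℝ] (ι → ℝ) →L[ℝ] ℝ)
    (hperm : ∀ (σ : Equiv.Perm ι) (q : ι → ℝ), B (q ∘ σ) (q ∘ σ) = B q q) (i j : ι) :
    B (Pi.single j 1) (Pi.single j 1) = B (Pi.single i 1) (Pi.single i 1) := by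
  rw [← hperm (Equiv.swap i j) (Pi.single j 1), single_comp_swap]

/-- **A CUBIC-SYMMETRIC QUADRATIC FORM IS ISOTROPIC**: the diagonal of `B` invariant under the coordinate sign flips and permutations
⟹ `B q q = B e_{i₀} e_{i₀} · Σ_j q_j²`. [folklore] -/
theorem diag_eq_mul_sum_sq (B : (ι → ℝ) →L[ℝ] (ι → ℝ) →L[ℝ] ℝ)
    (hflip : ∀ (j : ι) (q : ι → ℝ), B (update q j (-q j)) (update q j (-q j)) = B q q)
    (hperm : ∀ (σ : Equiv.Perm ι) (q : ι → ℝ), B (q ∘ σ) (q ∘ σ) = B q q) (i₀ : ι) (q : ι → ℝ) :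
    B q q = B (Pi.single i₀ 1) (Pi.single i₀ 1) * ∑ j, q j ^ 2 := by
  rw [diag_eq_sum_sq_mul_of_flip_invariant B hflip q, Finset.mul_sum]
  exact Finset.sum_congr rfl fun j _ => by rw [diag_single_eq_of_perm_invariant B hperm i₀ j, mul_comm]

omit [DecidableEq ι] in
/-- The sup norm of `ι → ℝ` against the main form: `‖q‖² ≤ Σ_j q_j²` (so IHPC §6's `μ = 1` for `m(q) = Σ_j q_j²`). [folklore] -/
theorem norm_sq_le_sum_sq (q : ι → ℝ) : ‖q‖ ^ 2 ≤ ∑ j, q j ^ 2 := by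
  have hS : 0 ≤ ∑ j, q j ^ 2 := Finset.sum_nonneg fun j _ => sq_nonneg (q j)
  have h : ‖q‖ ≤ Real.sqrt (∑ j, q j ^ 2) := by
    refine (pi_norm_le_iff_of_nonneg (Real.sqrt_nonneg _)).2 fun j => ?_
    rw [Real.norm_eq_abs, ← Real.sqrt_sq_eq_abs]
    exact Real.sqrt_le_sqrt (Finset.single_le_sum (fun i _ => sq_nonneg (q i)) (Finset.mem_univ j))
  calc ‖q‖ ^ 2 ≤ (Real.sqrt (∑ j, q j ^ 2)) ^ 2 := pow_le_pow_left₀ (norm_nonneg _) h 2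
    _ = ∑ j, q j ^ 2 := Real.sq_sqrt hS

end Algebra

/-! ## §3 THE END: the Hessian at `0` of a cubic-symmetric scalar kernel is `b·Σ_j q_j²` -/

section Hessian

variable {ι : Type*} [Fintype ι] [DecidableEq ι]

/-- **CUBIC SYMMETRY MAKES THE MARGINAL PART ISOTROPIC** [folklore]: `Φ : (ι → ℝ) → ℝ` invariant under every coordinate sign flip
`q ↦ update q j (−q j)` and every coordinate permutation `q ↦ q ∘ σ` ⟹
`D²Φ(0)[q,q] = D²Φ(0)[e_{i₀},e_{i₀}] · Σ_j q_j²` — IHPC §6's letter (S) with main form `m(q) = Σ_j q_j²` and coefficient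
`b = ½D²Φ(0)[e_{i₀},e_{i₀}]`; no regularity of `Φ` is asked (the identity is between Mathlib's `iteratedFDeriv`s, junk values included). -/
theorem hessian_diag_eq_mul_sum_sq {Φ : (ι → ℝ) → ℝ} (hflip : ∀ (j : ι) (q : ι → ℝ), Φ (update q j (-q j)) = Φ q)
    (hperm : ∀ (σ : Equiv.Perm ι) (q : ι → ℝ), Φ (q ∘ σ) = Φ q) (i₀ : ι) (q : ι → ℝ) :
    iteratedFDeriv ℝ 2 Φ 0 (fun _ => q) = iteratedFDeriv ℝ 2 Φ 0 (fun _ => Pi.single i₀ 1) * ∑ j, q j ^ 2 := by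
  set B : (ι → ℝ) →L[ℝ] (ι → ℝ) →L[ℝ] ℝ := fderiv ℝ (fderiv ℝ Φ) 0 with hB
  -- the flips as continuous linear equivalences
  have hflipB : ∀ (j : ι) (q : ι → ℝ), B (update q j (-q j)) (update q j (-q j)) = B q q := by
    intro j q
    let L : (ι → ℝ) →ₗ[ℝ] (ι → ℝ) :=
      { toFun := fun q => update q j (-q j)
        map_add' := fun a b => by
          funext i; by_cases hij : i = j
          · subst hij; simp; ring
          · simp [hij]
        map_smul' := fun c a => by
          funext i; by_cases hij : i = j
          · subst hij; simp
          · simp [hij] }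
    have hL : ∀ q : ι → ℝ, L q = update q j (-q j) := fun q => rfl
    have hinv : Involutive L := fun q => by
      rw [hL, hL]; funext i; by_cases hij : i = j
      · subst hij; simp
      · simp [hij]
    let A : (ι → ℝ) ≃L[ℝ] (ι → ℝ) := (LinearEquiv.ofInvolutive L hinv).toContinuousLinearEquiv
    have hA : ∀ q : ι → ℝ, A q = update q j (-q j) := fun q => rfl
    have h := hessian_apply_equiv_of_invariant A (fun q => by rw [hA]; exact hflip j q) q q
    rwa [hA] at h
  -- the permutations as continuous linear equivalences
  have hpermB : ∀ (σ : Equiv.Perm ι) (q : ι → ℝ), B (q ∘ σ) (q ∘ σ) = B q q := by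
    intro σ q
    let A : (ι → ℝ) ≃L[ℝ] (ι → ℝ) := (LinearEquiv.funCongrLeft ℝ ℝ σ).toContinuousLinearEquiv
    have hA : ∀ q : ι → ℝ, A q = q ∘ σ := fun q => rfl
    have h := hessian_apply_equiv_of_invariant A (fun q => by rw [hA]; exact hperm σ q) q q
    rwa [hA] at h
  have h := diag_eq_mul_sum_sq B hflipB hpermB i₀ q
  rw [iteratedFDeriv_two_apply, iteratedFDeriv_two_apply]
  exact h

/-- The same END in IHPC §6's `hsplit` shape: `½D²Φ(0)[q,q] = b · m(q)` with `m(q) = Σ_j q_j²`, `b = ½D²Φ(0)[e_{i₀},e_{i₀}]`. [folklore] -/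
theorem half_hessian_diag_eq {Φ : (ι → ℝ) → ℝ} (hflip : ∀ (j : ι) (q : ι → ℝ), Φ (update q j (-q j)) = Φ q)
    (hperm : ∀ (σ : Equiv.Perm ι) (q : ι → ℝ), Φ (q ∘ σ) = Φ q) (i₀ : ι) (q : ι → ℝ) :
    iteratedFDeriv ℝ 2 Φ 0 (fun _ => q) / 2 = (iteratedFDeriv ℝ 2 Φ 0 (fun _ => Pi.single i₀ 1) / 2) * ∑ j, q j ^ 2 := by
  rw [hessian_diag_eq_mul_sum_sq hflip hperm i₀ q]
  ring

end Hessian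

/-! ## §4 The lattice symbol of a cubic-symmetric kernel is cubic-symmetric (LKM's `d`-dimensional symbol, written out) -/

section Lattice

variable {ι : Type*} [Fintype ι] [DecidableEq ι]

omit [DecidableEq ι] in
/-- **TRANSPORT OF THE SYMBOL BY AN INDEX SYMMETRY**: if `g` permutes the support `s`, preserves the weights `k`, and is dual to the
momentum map `p ↦ p'` (`⟨g x, p⟩ = ⟨x, p'⟩`), then `Σ_{x∈s} k x·cos⟨x, p'⟩ = Σ_{x∈s} k x·cos⟨x, p⟩` (`Finset.sum_equiv`). [folklore] -/
theorem latticeSymbol_eq_of_symmetry {s : Finset (ι → ℤ)} {k : (ι → ℤ) → ℝ} (g : (ι → ℤ) ≃ (ι → ℤ))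
    (hs : ∀ x, x ∈ s ↔ g x ∈ s) (hk : ∀ x, k (g x) = k x) {p p' : ι → ℝ}
    (hdual : ∀ x : ι → ℤ, ∑ j, ((g x j : ℤ) : ℝ) * p j = ∑ j, ((x j : ℤ) : ℝ) * p' j) :
    ∑ x ∈ s, k x * Real.cos (∑ j, ((x j : ℤ) : ℝ) * p' j) = ∑ x ∈ s, k x * Real.cos (∑ j, ((x j : ℤ) : ℝ) * p j) :=
  Finset.sum_equiv g hs fun x _ => by rw [hk, hdual]

/-- **COORDINATE SIGN FLIPS**: a kernel on `ℤ^ι` whose support and weights are invariant under `x ↦ update x j (−x j)` has a symbol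
invariant under `p ↦ update p j (−p j)`. [folklore] -/
theorem latticeSymbol_flip_invariant {s : Finset (ι → ℤ)} {k : (ι → ℤ) → ℝ}
    (hs : ∀ (j : ι) (x : ι → ℤ), x ∈ s ↔ update x j (-x j) ∈ s) (hk : ∀ (j : ι) (x : ι → ℤ), k (update x j (-x j)) = k x)
    (j : ι) (p : ι → ℝ) :
    ∑ x ∈ s, k x * Real.cos (∑ i, ((x i : ℤ) : ℝ) * update p j (-p j) i)
      = ∑ x ∈ s, k x * Real.cos (∑ i, ((x i : ℤ) : ℝ) * p i) := by
  have hinv : Involutive fun x : ι → ℤ => update x j (-x j) := fun x => by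
    funext i; by_cases hij : i = j
    · subst hij; simp
    · simp [hij]
  refine latticeSymbol_eq_of_symmetry hinv.toPerm (fun x => hs j x) (fun x => hk j x) fun x => ?_
  refine Finset.sum_congr rfl fun i _ => ?_
  show (((update x j (-x j)) i : ℤ) : ℝ) * p i = ((x i : ℤ) : ℝ) * update p j (-p j) i
  by_cases hij : i = j
  · subst hij; simp
  · simp [hij]

omit [DecidableEq ι] in
/-- **COORDINATE PERMUTATIONS**: a kernel on `ℤ^ι` whose support and weights are invariant under every `x ↦ x ∘ σ` has a symbol invariant
under every `p ↦ p ∘ σ`. [folklore] -/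
theorem latticeSymbol_perm_invariant {s : Finset (ι → ℤ)} {k : (ι → ℤ) → ℝ}
    (hs : ∀ (σ : Equiv.Perm ι) (x : ι → ℤ), x ∈ s ↔ x ∘ σ ∈ s) (hk : ∀ (σ : Equiv.Perm ι) (x : ι → ℤ), k (x ∘ σ) = k x)
    (σ : Equiv.Perm ι) (p : ι → ℝ) :
    ∑ x ∈ s, k x * Real.cos (∑ i, ((x i : ℤ) : ℝ) * (p ∘ σ) i) = ∑ x ∈ s, k x * Real.cos (∑ i, ((x i : ℤ) : ℝ) * p i) := by
  -- the dual index symmetry of `p ↦ p ∘ σ` is `x ↦ x ∘ σ⁻¹`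
  have hg : ∀ x : ι → ℤ, (Equiv.arrowCongr σ (Equiv.refl ℤ)) x = x ∘ σ.symm := fun x => by
    funext i; simp [Equiv.arrowCongr_apply]
  refine latticeSymbol_eq_of_symmetry (Equiv.arrowCongr σ (Equiv.refl ℤ)) (fun x => by rw [hg]; exact hs σ.symm x)
    (fun x => by rw [hg]; exact hk σ.symm x) fun x => ?_
  rw [hg]
  -- `Σ_i x(σ⁻¹ i)·p i = Σ_m x m·p(σ m)` by reindexing `i = σ m`
  exact (Fintype.sum_equiv σ (fun m => ((x m : ℤ) : ℝ) * (p ∘ σ) m) (fun i => (((x ∘ σ.symm) i : ℤ) : ℝ) * p i)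
    fun m => by simp).symm

/-- **THE END FOR LKM's LATTICE SYMBOL** [folklore]: a finitely supported kernel `k` on `ℤ^ι` with CUBIC-SYMMETRIC support and weights
(invariant under the coordinate sign flips and permutations) has a symbol `Φ(p) = Σ_x k x·cos⟨x, p⟩` whose Hessian at `0` is isotropic:
`D²Φ(0)[q,q] = D²Φ(0)[e_{i₀},e_{i₀}] · Σ_j q_j²` — the marginal part of a cubic-symmetric lattice kernel is a multiple of the main form. -/
theorem latticeSymbol_hessian_diag_eq_mul_sum_sq {s : Finset (ι → ℤ)} {k : (ι → ℤ) → ℝ}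
    (hsf : ∀ (j : ι) (x : ι → ℤ), x ∈ s ↔ update x j (-x j) ∈ s) (hkf : ∀ (j : ι) (x : ι → ℤ), k (update x j (-x j)) = k x)
    (hsp : ∀ (σ : Equiv.Perm ι) (x : ι → ℤ), x ∈ s ↔ x ∘ σ ∈ s) (hkp : ∀ (σ : Equiv.Perm ι) (x : ι → ℤ), k (x ∘ σ) = k x)
    (i₀ : ι) (q : ι → ℝ) :
    iteratedFDeriv ℝ 2 (fun p : ι → ℝ => ∑ x ∈ s, k x * Real.cos (∑ i, ((x i : ℤ) : ℝ) * p i)) 0 (fun _ => q)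
      = iteratedFDeriv ℝ 2 (fun p : ι → ℝ => ∑ x ∈ s, k x * Real.cos (∑ i, ((x i : ℤ) : ℝ) * p i)) 0
          (fun _ => Pi.single i₀ 1) * ∑ j, q j ^ 2 :=
  hessian_diag_eq_mul_sum_sq (fun j p => latticeSymbol_flip_invariant hsf hkf j p)
    (fun σ p => latticeSymbol_perm_invariant hsp hkp σ p) i₀ q

end Lattice

/-! ## §5 Toy (kernel): the hypotheses are inhabited -/

/-- `Φ q = Σ_j q_j²` on `Fin 3 → ℝ` is flip- and permutation-invariant, so the END applies to it. [folklore] -/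
example (q : Fin 3 → ℝ) :
    iteratedFDeriv ℝ 2 (fun p : Fin 3 → ℝ => ∑ j, p j ^ 2) 0 (fun _ => q)
      = iteratedFDeriv ℝ 2 (fun p : Fin 3 → ℝ => ∑ j, p j ^ 2) 0 (fun _ => Pi.single 0 1) * ∑ j, q j ^ 2 := by
  refine hessian_diag_eq_mul_sum_sq (fun j p => ?_) (fun σ p => ?_) 0 q
  · -- flip invariance: `(−p j)² = p j²`
    refine Finset.sum_congr rfl fun i _ => ?_
    by_cases hij : i = j
    · subst hij; simp
    · simp [hij]
  · -- permutation invariance: reindex the sum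
    exact Fintype.sum_equiv σ (fun i => (p ∘ σ) i ^ 2) (fun i => p i ^ 2) fun i => rfl

end Summit.QuantumFields.BalabanUV.T4Continuum.NE7b.CubicSymmetricKernelMarginal

end
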